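import Summits.QuantumFields.YangMills.Theorems.LuscherReductionOneSiteLevelsValleyNear

/-!
# VALLEY, step 5a: the per-shell supersolution bounds (FAR ∪ NEAR)
# (support module for `stub_absUpperValleyMag` of crux `OneSiteLevels`, route `LuscherReduction`, item stmt-QuantumFields-20007;
# fleet lead prover ym-luscher-20007-p1 g2)

The two hypotheses `h1`, `h2` of the two-shell assembly `qform_le_of_twoShell` ask for uniform bounds on
`J_τ(U) = e^{(τ−½)BS(U)} ∫ E_B(U,V) e^{−(½+τ)BS(V)} dV` on the lower shell (`ρ₀ ≤ ρ(U) < t`, weight exponent `τ = 1/(8t)`) and on the upper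
shell (`ρ(U) ≥ t`, `τ = 0`).  This file derives them from the FAR bounds (`valleyJ_le_of_far`, `valleyJ_zero_le`: `B·S(U)` large) and the NEAR
bound (`valleyJ_le_of_near`: `B·S(U)` small), with every `U`-dependence replaced by shell-uniform quantities:
* `shell1_J_le`: for `T + 1/8 ≤ 7/50`, `T ≤ t ≤ 2T`, `ρ₀ ≤ ρ(U) < t`:
  `J_{1/(8t)}(U) ≤ linkCE B/(1 − 27/B) · max(16√2 e^{−5}, (1 + 18ε₁)(1 − (5/16) min((1−36δ')ρ₀²/(16T), 1/500)) + 512 e^{−Bδ'/4})`;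
* `shell2_J_le`: for `t ≤ ρ(U)`:
  `J_0(U) ≤ linkCE B/(1 − 27/B) · max(e^{−1/200000}, (1 + 18ε₂) e^{(27/4 + 9δ')/100000}(1 − (5/16) min((1−36δ')t²/2, 1/500)) + 512 e^{−Bδ'/4})`,
with `ε₁ = (9/4)δ' + (½ + 1/(8T))(2√2√(10/B) + 9δ'(2+36δ'))`, `ε₂ = (9/4)δ' + ½(2√2√(1/(100000B)) + 9δ'(2+36δ'))`.

## WHAT THIS IS NOT
Not the assembled valley estimate (parameters are chosen in `…ValleyMain`); NOT the crux, NOT THE CLAY GAP.  Sorry-free; no new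
definition, no named fact.
-/

set_option autoImplicit false

noncomputable section

open MeasureTheory Filter Topology Real
open scoped Matrix Quaternion RealInnerProductSpace BigOperators
open Literature.MathematicalPhysics.QuantumFieldTheory
open Literature.MathematicalPhysics.QuantumLattice
open Literature.Analysis.OperatorTheory.YMMatrixModel

namespace Summit.QuantumFields.YangMills.Theorems.FemtoTransferGap

variable {B : ℝ}

/-! ### §1. Two coarse bounds: `S(U) ≤ 2ρ(U)⁴`, `ρ(U)² ≤ 3` -/

/-- `S(U) ≤ 2ρ(U)⁴`. [folklore] -/
theorem wilsonAction_le_two_mul_norm_pow_four (U : Cfg) : wilsonAction su2Rep U ≤ 2 * ‖zmCoord 1 U‖ ^ 4 := by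
  rw [wilsonAction_eq_two_mul_sum_cross, show ‖zmCoord 1 U‖ ^ 4 = (‖zmCoord 1 U‖ ^ 2) ^ 2 by ring, norm_zmCoord_sq_eq_sum_dot,
    sq, Fintype.sum_mul_sum, Fintype.sum_prod_type]
  refine mul_le_mul_of_nonneg_left (Finset.sum_le_sum fun i _ => Finset.sum_le_sum fun j _ => ?_) (by norm_num)
  have h := sqrt_cross_dot_self_le (colourVec (zmCoord 1 U) i) (colourVec (zmCoord 1 U) j)
  have h0 : 0 ≤ (colourVec (zmCoord 1 U) i ⨯₃ colourVec (zmCoord 1 U) j) ⬝ᵥ (colourVec (zmCoord 1 U) i ⨯₃ colourVec (zmCoord 1 U) j) :=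
    Finset.sum_nonneg fun _ _ => mul_self_nonneg _
  have hi : 0 ≤ colourVec (zmCoord 1 U) i ⬝ᵥ colourVec (zmCoord 1 U) i := Finset.sum_nonneg fun _ _ => mul_self_nonneg _
  have hj : 0 ≤ colourVec (zmCoord 1 U) j ⬝ᵥ colourVec (zmCoord 1 U) j := Finset.sum_nonneg fun _ _ => mul_self_nonneg _
  have h1 := pow_le_pow_left₀ (Real.sqrt_nonneg _) h 2
  rw [Real.sq_sqrt h0, mul_pow, Real.sq_sqrt hi, Real.sq_sqrt hj] at h1
  exact h1

/-- `ρ(U)² ≤ 3`. [folklore] -/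
theorem norm_zmCoord_sq_le_three (U : Cfg) : ‖zmCoord 1 U‖ ^ 2 ≤ 3 := by
  rw [norm_zmCoord_sq_eq_sum_dot]
  calc ∑ i : Fin 3, colourVec (zmCoord 1 U) i ⬝ᵥ colourVec (zmCoord 1 U) i ≤ ∑ _i : Fin 3, (1:ℝ) :=
        Finset.sum_le_sum fun i _ => by
          rw [colourVec_zmCoord_one, vecPart_dot_self]
          nlinarith [scalarPart_sq_add (U (edgeOf i)), sq_nonneg (scalarPart (U (edgeOf i)))]
    _ = 3 := by simp

/-- The FAR/shell-1 geometric hypothesis from `(½+τ)ρ ≤ 7/50` and `ρ ≤ 2T ≤ 1/10`: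
`16(½+τ)²ρ² + 2√2(½+τ)√S ≤ ½`. [folklore] -/
theorem shell1_geom {τ ρ S : ℝ} (hτ : 0 ≤ 1 / 2 + τ) (hρ : 0 ≤ ρ) (hS : S ≤ 2 * ρ ^ 4)
    (h1 : (1 / 2 + τ) * ρ ≤ 7 / 50) (h2 : ρ ≤ 1 / 10) :
    16 * (1 / 2 + τ) ^ 2 * ρ ^ 2 + 2 * Real.sqrt 2 * (1 / 2 + τ) * √S ≤ 1 / 2 := by
  have hs : √S ≤ Real.sqrt 2 * ρ ^ 2 := by
    rw [← Real.sqrt_sq (sq_nonneg ρ), ← Real.sqrt_mul (by norm_num)]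
    exact Real.sqrt_le_sqrt (by nlinarith)
  have h22 : Real.sqrt 2 * Real.sqrt 2 = 2 := Real.mul_self_sqrt (by norm_num)
  have h3 : 2 * Real.sqrt 2 * (1 / 2 + τ) * √S ≤ 4 * ((1 / 2 + τ) * ρ) * ρ := by
    have h4 := mul_le_mul_of_nonneg_left hs (by positivity : (0:ℝ) ≤ 2 * Real.sqrt 2 * (1 / 2 + τ))
    have e : 2 * Real.sqrt 2 * (1 / 2 + τ) * (Real.sqrt 2 * ρ ^ 2) = 2 * (Real.sqrt 2 * Real.sqrt 2) * ((1 / 2 + τ) * ρ) * ρ := by ring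
    rw [h22] at e
    linarith
  have hp0 : 0 ≤ (1 / 2 + τ) * ρ := mul_nonneg hτ hρ
  have hp2 : ((1 / 2 + τ) * ρ) ^ 2 ≤ (7 / 50) ^ 2 := pow_le_pow_left₀ hp0 h1 2
  have hpr : ((1 / 2 + τ) * ρ) * ρ ≤ (7 / 50) * (1 / 10) := mul_le_mul h1 h2 hρ (by norm_num)
  have e2 : 16 * (1 / 2 + τ) ^ 2 * ρ ^ 2 = 16 * ((1 / 2 + τ) * ρ) ^ 2 := by ring
  rw [e2]
  linarith

/-! ### §2. Shell 1: `ρ₀ ≤ ρ < t`, `τ = 1/(8t)` -/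
set_option maxHeartbeats 400000 in
/-- **Shell-1 supersolution bound** (FAR ∪ NEAR). [cite: SimonB1983DiscreteSpectrum, §2] [cite: Luscher1983, §2] -/
theorem shell1_J_le (hB : 54 ≤ B) {T t : ℝ} (hT0 : 0 < T) (hT : T + 1 / 8 ≤ 7 / 50) (htT : T ≤ t) (ht2T : t ≤ 2 * T)
    {δ' : ℝ} (hδ'0 : 0 < δ') (hδ' : δ' ≤ 1 / 72)
    (hεB : 9 / 4 * δ' + (1 / 2 + 1 / (8 * T)) * (2 * Real.sqrt 2 * √(10 / B) + 9 * δ' * (2 + 36 * δ')) ≤ 1 / 18)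
    {ρ₀ : ℝ} (hρ₀0 : 0 < ρ₀) (U : Cfg) (hρ₀ : ρ₀ ≤ ‖zmCoord 1 U‖) (hρt : ‖zmCoord 1 U‖ < t) :
    Real.exp ((1 / (8 * t) - 1 / 2) * B * wilsonAction su2Rep U) *
        ∫ V, linkE B U V * Real.exp (-(1 / 2 + 1 / (8 * t)) * B * wilsonAction su2Rep V) ∂(configMeasure SU2 1)
      ≤ linkCE B / (1 - 27 / B) * max (16 * Real.sqrt 2 * Real.exp (-5))
          ((1 + 18 * (9 / 4 * δ' + (1 / 2 + 1 / (8 * T)) * (2 * Real.sqrt 2 * √(10 / B) + 9 * δ' * (2 + 36 * δ'))))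
            * (1 - 5 / 16 * min (1 / (16 * T) * (1 - 36 * δ') * ρ₀ ^ 2) (1 / 500)) + 512 * Real.exp (-(B * δ' / 4))) := by
  have hB0 : 0 < B := by linarith
  have ht0 : 0 < t := lt_of_lt_of_le hT0 htT
  have hρ0 : 0 < ‖zmCoord 1 U‖ := lt_of_lt_of_le hρ₀0 hρ₀
  have hS0 : 0 ≤ (wilsonAction su2Rep U) := wilsonAction_su2_nonneg U
  have hτ0 : (0:ℝ) < 1 / (8 * t) := by positivity
  have hτ' : 0 ≤ 1 / 2 + (1 / (8 * t)) := by linarith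
  have hτT : 1 / (8 * t) ≤ 1 / (8 * T) := one_div_le_one_div_of_le (by positivity) (by linarith)
  have hτT' : 1 / (16 * T) ≤ 1 / (8 * t) := one_div_le_one_div_of_le (by positivity) (by linarith)
  -- (½+(1 / (8 * t)))‖zmCoord 1 U‖ ≤ t/2 + ‖zmCoord 1 U‖/(8t) ≤ t/2 + 1/8 ≤ T + 1/8 ≤ 7/50
  have hgeom1 : (1 / 2 + (1 / (8 * t))) * ‖zmCoord 1 U‖ ≤ 7 / 50 := by
    have h1 : 1 / (8 * t) * ‖zmCoord 1 U‖ ≤ 1 / 8 := by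
      rw [div_mul_eq_mul_div, one_mul, div_le_iff₀ (by positivity)]; linarith
    nlinarith
  have hρle : ‖zmCoord 1 U‖ ≤ 1 / 10 := by linarith
  have hgeom := shell1_geom hτ' hρ0.le (wilsonAction_le_two_mul_norm_pow_four U) hgeom1 hρle
  -- 𝒢 ≤ linkCE/(1 − 27/B)
  have h27 : 0 < 1 - 27 / B := by rw [sub_pos, div_lt_one hB0]; linarith
  have h𝒢 : Real.exp (6 * B) * Real.sqrt (π / B) ^ 9 / (2 * π ^ 2) ^ 3 ≤ linkCE B / (1 - 27 / B) := by
    rw [le_div_iff₀ h27, mul_comm]; exact gauss_le_linkCE hB0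
  have hL0 : 0 ≤ linkCE B / (1 - 27 / B) := div_nonneg (linkCE_pos hB0.le).le h27.le
  by_cases hfar : 10 ≤ B * (wilsonAction su2Rep U)
  · -- FAR
    have h := valleyJ_le_of_far hB0 hτ' U hgeom
    refine h.trans ?_
    have he : Real.exp (-(B / 2) * (wilsonAction su2Rep U)) ≤ Real.exp (-5) := Real.exp_le_exp.2 (by linarith)
    calc 16 * Real.sqrt 2 * Real.exp (-(B / 2) * (wilsonAction su2Rep U)) * (Real.exp (6 * B) * Real.sqrt (π / B) ^ 9 / (2 * π ^ 2) ^ 3)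
        ≤ 16 * Real.sqrt 2 * Real.exp (-5) * (linkCE B / (1 - 27 / B)) :=
          mul_le_mul (mul_le_mul_of_nonneg_left he (by positivity)) h𝒢 (by positivity) (by positivity)
      _ = linkCE B / (1 - 27 / B) * (16 * Real.sqrt 2 * Real.exp (-5)) := by ring
      _ ≤ _ := mul_le_mul_of_nonneg_left (le_max_left _ _) hL0
  · -- NEAR
    push Not at hfar
    have hSB : √(wilsonAction su2Rep U) ≤ √(10 / B) := Real.sqrt_le_sqrt (by rw [le_div_iff₀ hB0]; linarith)
    set ε₁ : ℝ := 9 / 4 * δ' + (1 / 2 + 1 / (8 * T)) * (2 * Real.sqrt 2 * √(10 / B) + 9 * δ' * (2 + 36 * δ')) with hε₁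
    have hεU : 9 / 4 * δ' + (1 / 2 + (1 / (8 * t))) * (2 * Real.sqrt 2 * √(wilsonAction su2Rep U) + 9 * δ' * (2 + 36 * δ')) ≤ ε₁ := by
      rw [hε₁]
      have h1 : 2 * Real.sqrt 2 * √(wilsonAction su2Rep U) + 9 * δ' * (2 + 36 * δ') ≤ 2 * Real.sqrt 2 * √(10 / B) + 9 * δ' * (2 + 36 * δ') := by
        have := mul_le_mul_of_nonneg_left hSB (by positivity : (0:ℝ) ≤ 2 * Real.sqrt 2)
        linarith
      have h0 : 0 ≤ 2 * Real.sqrt 2 * √(wilsonAction su2Rep U) + 9 * δ' * (2 + 36 * δ') := by positivity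
      nlinarith [mul_le_mul hτT h1 h0 (by positivity : (0:ℝ) ≤ 1 / (8 * T))]
    have hgs : 64 * (1 / 2 + (1 / (8 * t))) ^ 2 * ‖zmCoord 1 U‖ ^ 2 * (B * (wilsonAction su2Rep U)) ≤ 100 := by
      have h1 : (1 / 2 + (1 / (8 * t))) ^ 2 * ‖zmCoord 1 U‖ ^ 2 ≤ (7 / 50) ^ 2 := by
        rw [← mul_pow]; exact pow_le_pow_left₀ (by positivity) hgeom1 2
      have h2 := mul_le_mul h1 hfar.le (by positivity) (by norm_num)
      linarith only [h2]
    -- simplify the NEAR bound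
    have hexp : Real.exp (B * (wilsonAction su2Rep U) * (9 * (1 / 2 + (1 / (8 * t))) ^ 2 * ‖zmCoord 1 U‖ ^ 2 + 18 * δ' * (1 / 2 + (1 / (8 * t))) - 1)) ≤ 1 := by
      rw [Real.exp_le_one_iff]
      have h1 : 9 * (1 / 2 + (1 / (8 * t))) ^ 2 * ‖zmCoord 1 U‖ ^ 2 ≤ 9 * (7 / 50) ^ 2 := by
        have : (1 / 2 + (1 / (8 * t))) ^ 2 * ‖zmCoord 1 U‖ ^ 2 ≤ (7 / 50) ^ 2 := by rw [← mul_pow]; exact pow_le_pow_left₀ (by positivity) hgeom1 2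
        linarith
      have h2 : 18 * δ' * (1 / 2 + (1 / (8 * t))) ≤ 1 / 18 := by
        have h3 := hεU.trans hεB
        have hPE : 0 ≤ (1 / 2 + 1 / (8 * t)) * (2 * Real.sqrt 2 * √(wilsonAction su2Rep U)) := mul_nonneg hτ' (by positivity)
        have hD : 18 * δ' ≤ 9 * δ' * (2 + 36 * δ') := by nlinarith only [hδ'0]
        have hPD := mul_le_mul_of_nonneg_left hD hτ'
        have e : (1 / 2 + 1 / (8 * t)) * (2 * Real.sqrt 2 * √(wilsonAction su2Rep U) + 9 * δ' * (2 + 36 * δ'))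
            = (1 / 2 + 1 / (8 * t)) * (2 * Real.sqrt 2 * √(wilsonAction su2Rep U)) + (1 / 2 + 1 / (8 * t)) * (9 * δ' * (2 + 36 * δ')) :=
          mul_add _ _ _
        linarith only [h3, hPE, hPD, e, hδ'0.le]
      have : 9 * (1 / 2 + (1 / (8 * t))) ^ 2 * ‖zmCoord 1 U‖ ^ 2 + 18 * δ' * (1 / 2 + (1 / (8 * t))) - 1 ≤ 0 := by linarith only [h1, h2]
      exact mul_nonpos_of_nonneg_of_nonpos (by positivity) this
    have hmin : min (1 / (16 * T) * (1 - 36 * δ') * ρ₀ ^ 2) (1 / 500) ≤ min ((1 / 2 + (1 / (8 * t))) * (1 - 36 * δ') * ‖zmCoord 1 U‖ ^ 2) (1 / 500) := by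
      refine min_le_min ?_ le_rfl
      have h1 : 1 / (16 * T) ≤ 1 / 2 + (1 / (8 * t)) := by linarith
      have h2 : ρ₀ ^ 2 ≤ ‖zmCoord 1 U‖ ^ 2 := pow_le_pow_left₀ hρ₀0.le hρ₀ 2
      have h3 : 0 ≤ 1 - 36 * δ' := by linarith
      calc 1 / (16 * T) * (1 - 36 * δ') * ρ₀ ^ 2 ≤ (1 / 2 + (1 / (8 * t))) * (1 - 36 * δ') * ρ₀ ^ 2 :=
            mul_le_mul_of_nonneg_right (mul_le_mul_of_nonneg_right h1 h3) (sq_nonneg _)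
        _ ≤ (1 / 2 + (1 / (8 * t))) * (1 - 36 * δ') * ‖zmCoord 1 U‖ ^ 2 := mul_le_mul_of_nonneg_left h2 (mul_nonneg hτ' h3)
    have hε0 : 0 ≤ 9 / 4 * δ' + (1 / 2 + (1 / (8 * t))) * (2 * Real.sqrt 2 * √(wilsonAction su2Rep U) + 9 * δ' * (2 + 36 * δ')) := by positivity
    have hm500 : min ((1 / 2 + (1 / (8 * t))) * (1 - 36 * δ') * ‖zmCoord 1 U‖ ^ 2) (1 / 500) ≤ 1 / 500 := min_le_right _ _
    have hA : (1 + 18 * (9 / 4 * δ' + (1 / 2 + (1 / (8 * t))) * (2 * Real.sqrt 2 * √(wilsonAction su2Rep U) + 9 * δ' * (2 + 36 * δ'))))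
          * Real.exp (B * (wilsonAction su2Rep U) * (9 * (1 / 2 + (1 / (8 * t))) ^ 2 * ‖zmCoord 1 U‖ ^ 2 + 18 * δ' * (1 / 2 + (1 / (8 * t))) - 1))
          * (1 - 5 / 16 * min ((1 / 2 + (1 / (8 * t))) * (1 - 36 * δ') * ‖zmCoord 1 U‖ ^ 2) (1 / 500))
        ≤ (1 + 18 * ε₁) * (1 - 5 / 16 * min (1 / (16 * T) * (1 - 36 * δ') * ρ₀ ^ 2) (1 / 500)) := by
      have hg0 : 0 ≤ 1 - 5 / 16 * min ((1 / 2 + (1 / (8 * t))) * (1 - 36 * δ') * ‖zmCoord 1 U‖ ^ 2) (1 / 500) := by linarith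
      calc _ ≤ (1 + 18 * ε₁) * 1 * (1 - 5 / 16 * min ((1 / 2 + (1 / (8 * t))) * (1 - 36 * δ') * ‖zmCoord 1 U‖ ^ 2) (1 / 500)) := by
            refine mul_le_mul_of_nonneg_right (mul_le_mul (by linarith) hexp (Real.exp_pos _).le (by positivity)) hg0
        _ ≤ (1 + 18 * ε₁) * (1 - 5 / 16 * min (1 / (16 * T) * (1 - 36 * δ') * ρ₀ ^ 2) (1 / 500)) := by
            rw [mul_one]; exact mul_le_mul_of_nonneg_left (by linarith) (by positivity)
    have hR0 : 0 ≤ (1 + 18 * ε₁) * (1 - 5 / 16 * min (1 / (16 * T) * (1 - 36 * δ') * ρ₀ ^ 2) (1 / 500))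
        + 512 * Real.exp (-(B * δ' / 4)) := by
      have h1 : min (1 / (16 * T) * (1 - 36 * δ') * ρ₀ ^ 2) (1 / 500) ≤ 1 / 500 := min_le_right _ _
      have h2 : 0 ≤ ε₁ := le_trans hε0 hεU
      have h3 : 0 ≤ 1 - 5 / 16 * min (1 / (16 * T) * (1 - 36 * δ') * ρ₀ ^ 2) (1 / 500) := by linarith only [h1]
      exact add_nonneg (mul_nonneg (by linarith only [h2]) h3) (by positivity)
    have hF : ∀ W : Cfg, Real.exp (((1 / (8 * t)) - 1 / 2) * B * (wilsonAction su2Rep U)) *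
        (linkE B U (U * W) * Real.exp (-(1 / 2 + (1 / (8 * t))) * B * wilsonAction su2Rep (U * W)))
        ≤ Real.exp (6 * B - B / 2 * ∑ e : Edge 3 1, (2 - 2 * scalarPart (W e))) := by
      intro W
      refine (valleyJ_integrand_le hB0 hτ' U W hgeom).trans ?_
      rw [← Real.exp_add, ← Real.exp_add]
      refine Real.exp_le_exp.2 ?_
      have : 0 ≤ B / 2 * (wilsonAction su2Rep U) := by positivity
      linarith
    have h := valleyJ_le_of_near hB0 (by linarith) U hρ0 hδ'0 hδ' hF (hεU.trans hεB) hgs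
    refine h.trans ?_
    calc (Real.exp (6 * B) * Real.sqrt (π / B) ^ 9 / (2 * π ^ 2) ^ 3) *
          ((1 + 18 * (9 / 4 * δ' + (1 / 2 + (1 / (8 * t))) * (2 * Real.sqrt 2 * √(wilsonAction su2Rep U) + 9 * δ' * (2 + 36 * δ'))))
            * Real.exp (B * (wilsonAction su2Rep U) * (9 * (1 / 2 + (1 / (8 * t))) ^ 2 * ‖zmCoord 1 U‖ ^ 2 + 18 * δ' * (1 / 2 + (1 / (8 * t))) - 1))
            * (1 - 5 / 16 * min ((1 / 2 + (1 / (8 * t))) * (1 - 36 * δ') * ‖zmCoord 1 U‖ ^ 2) (1 / 500)) + 512 * Real.exp (-(B * δ' / 4)))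
        ≤ (linkCE B / (1 - 27 / B)) * ((1 + 18 * ε₁) * (1 - 5 / 16 * min (1 / (16 * T) * (1 - 36 * δ') * ρ₀ ^ 2) (1 / 500))
            + 512 * Real.exp (-(B * δ' / 4))) :=
          mul_le_mul h𝒢 (by linarith only [hA])
            (add_nonneg (mul_nonneg (mul_nonneg (by linarith only [hε0]) (Real.exp_pos _).le) (by linarith only [hm500]))
              (by positivity)) hL0
      _ ≤ _ := mul_le_mul_of_nonneg_left (le_max_right _ _) hL0

/-! ### §3. Shell 2: `ρ ≥ t`, `τ = 0` -/

/-- **Shell-2 supersolution bound** (FAR ∪ NEAR). [cite: SimonB1983DiscreteSpectrum, §2] [cite: Luscher1983, §2] -/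
theorem shell2_J_le (hB : 54 ≤ B) {t : ℝ} (ht0 : 0 < t) {δ' : ℝ} (hδ'0 : 0 < δ') (hδ' : δ' ≤ 1 / 72)
    (hεB : 9 / 4 * δ' + 1 / 2 * (2 * Real.sqrt 2 * √(1 / (100000 * B)) + 9 * δ' * (2 + 36 * δ')) ≤ 1 / 18)
    (U : Cfg) (hρt : t ≤ ‖zmCoord 1 U‖) :
    Real.exp ((0 - 1 / 2) * B * wilsonAction su2Rep U) *
        ∫ V, linkE B U V * Real.exp (-(1 / 2 + 0) * B * wilsonAction su2Rep V) ∂(configMeasure SU2 1)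
      ≤ linkCE B / (1 - 27 / B) * max (Real.exp (-(1 / 200000)))
          ((1 + 18 * (9 / 4 * δ' + 1 / 2 * (2 * Real.sqrt 2 * √(1 / (100000 * B)) + 9 * δ' * (2 + 36 * δ'))))
            * Real.exp ((27 / 4 + 9 * δ') / 100000)
            * (1 - 5 / 16 * min (1 / 2 * (1 - 36 * δ') * t ^ 2) (1 / 500)) + 512 * Real.exp (-(B * δ' / 4))) := by
  have hB0 : 0 < B := by linarith
  have hρ0 : 0 < ‖zmCoord 1 U‖ := lt_of_lt_of_le ht0 hρt
  have hS0 : 0 ≤ wilsonAction su2Rep U := wilsonAction_su2_nonneg U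
  have hρ3 := norm_zmCoord_sq_le_three U
  have h27 : 0 < 1 - 27 / B := by rw [sub_pos, div_lt_one hB0]; linarith
  have h27'' : (0:ℝ) ≤ 27 / B := by positivity
  have h27' : 1 - 27 / B ≤ 1 := by linarith only [h27'']
  have h𝒢 : Real.exp (6 * B) * Real.sqrt (π / B) ^ 9 / (2 * π ^ 2) ^ 3 ≤ linkCE B / (1 - 27 / B) := by
    rw [le_div_iff₀ h27, mul_comm]; exact gauss_le_linkCE hB0
  have hL0 : 0 ≤ linkCE B / (1 - 27 / B) := div_nonneg (linkCE_pos hB0.le).le h27.le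
  have hLL : linkCE B ≤ linkCE B / (1 - 27 / B) := by
    rw [le_div_iff₀ h27]; nlinarith [linkCE_pos hB0.le]
  by_cases hfar : 1 / 100000 ≤ B * wilsonAction su2Rep U
  · -- FAR
    refine (valleyJ_zero_le hB0 U).trans ?_
    have he : Real.exp (-(B / 2) * wilsonAction su2Rep U) ≤ Real.exp (-(1 / 200000)) := Real.exp_le_exp.2 (by linarith)
    calc Real.exp (-(B / 2) * wilsonAction su2Rep U) * linkCE B ≤ Real.exp (-(1 / 200000)) * (linkCE B / (1 - 27 / B)) :=
          mul_le_mul he hLL (linkCE_pos hB0.le).le (Real.exp_pos _).le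
      _ = linkCE B / (1 - 27 / B) * Real.exp (-(1 / 200000)) := by ring
      _ ≤ _ := mul_le_mul_of_nonneg_left (le_max_left _ _) hL0
  · -- NEAR
    push Not at hfar
    have hSB : √(wilsonAction su2Rep U) ≤ √(1 / (100000 * B)) :=
      Real.sqrt_le_sqrt (by rw [le_div_iff₀ (by positivity)]; linarith)
    set ε₂ : ℝ := 9 / 4 * δ' + 1 / 2 * (2 * Real.sqrt 2 * √(1 / (100000 * B)) + 9 * δ' * (2 + 36 * δ')) with hε₂
    have hεU : 9 / 4 * δ' + (1 / 2 + 0) * (2 * Real.sqrt 2 * √(wilsonAction su2Rep U) + 9 * δ' * (2 + 36 * δ')) ≤ ε₂ := by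
      rw [hε₂]
      have := mul_le_mul_of_nonneg_left hSB (by positivity : (0:ℝ) ≤ 2 * Real.sqrt 2)
      linarith
    have hε0 : 0 ≤ 9 / 4 * δ' + (1 / 2 + 0) * (2 * Real.sqrt 2 * √(wilsonAction su2Rep U) + 9 * δ' * (2 + 36 * δ')) := by positivity
    have hgs : 64 * (1 / 2 + 0) ^ 2 * ‖zmCoord 1 U‖ ^ 2 * (B * wilsonAction su2Rep U) ≤ 100 := by
      have h1 : ‖zmCoord 1 U‖ ^ 2 * (B * wilsonAction su2Rep U) ≤ 3 * (1 / 100000) :=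
        mul_le_mul hρ3 hfar.le (by positivity) (by norm_num)
      nlinarith only [h1]
    have hexp : Real.exp (B * wilsonAction su2Rep U * (9 * (1 / 2 + 0) ^ 2 * ‖zmCoord 1 U‖ ^ 2 + 18 * δ' * (1 / 2 + 0) - 1))
        ≤ Real.exp ((27 / 4 + 9 * δ') / 100000) := by
      refine Real.exp_le_exp.2 ?_
      have h1 : 9 * (1 / 2 + 0) ^ 2 * ‖zmCoord 1 U‖ ^ 2 + 18 * δ' * (1 / 2 + 0) - 1 ≤ 27 / 4 + 9 * δ' := by nlinarith only [hρ3]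
      have h2 : 0 ≤ 27 / 4 + 9 * δ' := by positivity
      have h3 : 0 ≤ B * wilsonAction su2Rep U := by positivity
      calc B * wilsonAction su2Rep U * (9 * (1 / 2 + 0) ^ 2 * ‖zmCoord 1 U‖ ^ 2 + 18 * δ' * (1 / 2 + 0) - 1)
          ≤ B * wilsonAction su2Rep U * (27 / 4 + 9 * δ') := mul_le_mul_of_nonneg_left h1 h3
        _ ≤ 1 / 100000 * (27 / 4 + 9 * δ') := mul_le_mul_of_nonneg_right hfar.le h2
        _ = (27 / 4 + 9 * δ') / 100000 := by ring
    have hmin : min (1 / 2 * (1 - 36 * δ') * t ^ 2) (1 / 500) ≤ min ((1 / 2 + 0) * (1 - 36 * δ') * ‖zmCoord 1 U‖ ^ 2) (1 / 500) := by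
      refine min_le_min ?_ le_rfl
      have h2 : t ^ 2 ≤ ‖zmCoord 1 U‖ ^ 2 := pow_le_pow_left₀ ht0.le hρt 2
      have h3' : 0 ≤ 1 - 36 * δ' := by linarith only [hδ']
      have h3 : 0 ≤ 1 / 2 * (1 - 36 * δ') := by positivity
      rw [show (1 / 2 + (0:ℝ)) = 1 / 2 by ring]
      exact mul_le_mul_of_nonneg_left h2 h3
    have hm500 : min ((1 / 2 + 0) * (1 - 36 * δ') * ‖zmCoord 1 U‖ ^ 2) (1 / 500) ≤ 1 / 500 := min_le_right _ _
    have hA : (1 + 18 * (9 / 4 * δ' + (1 / 2 + 0) * (2 * Real.sqrt 2 * √(wilsonAction su2Rep U) + 9 * δ' * (2 + 36 * δ'))))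
          * Real.exp (B * wilsonAction su2Rep U * (9 * (1 / 2 + 0) ^ 2 * ‖zmCoord 1 U‖ ^ 2 + 18 * δ' * (1 / 2 + 0) - 1))
          * (1 - 5 / 16 * min ((1 / 2 + 0) * (1 - 36 * δ') * ‖zmCoord 1 U‖ ^ 2) (1 / 500))
        ≤ (1 + 18 * ε₂) * Real.exp ((27 / 4 + 9 * δ') / 100000) * (1 - 5 / 16 * min (1 / 2 * (1 - 36 * δ') * t ^ 2) (1 / 500)) := by
      have hg0 : 0 ≤ 1 - 5 / 16 * min ((1 / 2 + 0) * (1 - 36 * δ') * ‖zmCoord 1 U‖ ^ 2) (1 / 500) := by linarith only [hm500]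
      calc _ ≤ (1 + 18 * ε₂) * Real.exp ((27 / 4 + 9 * δ') / 100000)
            * (1 - 5 / 16 * min ((1 / 2 + 0) * (1 - 36 * δ') * ‖zmCoord 1 U‖ ^ 2) (1 / 500)) :=
            mul_le_mul_of_nonneg_right (mul_le_mul (by linarith only [hεU]) hexp (Real.exp_pos _).le (by positivity)) hg0
        _ ≤ _ := mul_le_mul_of_nonneg_left (by linarith only [hmin]) (by positivity)
    have hF : ∀ W : Cfg, Real.exp ((0 - 1 / 2) * B * wilsonAction su2Rep U) *
        (linkE B U (U * W) * Real.exp (-(1 / 2 + 0) * B * wilsonAction su2Rep (U * W)))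
        ≤ Real.exp (6 * B - B / 2 * ∑ e : Edge 3 1, (2 - 2 * scalarPart (W e))) := by
      intro W
      rw [linkE_mul_eq, ← Real.exp_add, ← Real.exp_add]
      refine Real.exp_le_exp.2 ?_
      have h3 : 0 ≤ B * wilsonAction su2Rep (U * W) := mul_nonneg hB0.le (wilsonAction_su2_nonneg (U * W))
      have h4 : 0 ≤ B * ∑ e : Edge 3 1, (2 - 2 * scalarPart (W e)) := mul_nonneg hB0.le (sumDefect_nonneg W)
      have h5 : 0 ≤ B * wilsonAction su2Rep U := mul_nonneg hB0.le hS0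
      linarith only [h3, h4, h5]
    have h := valleyJ_le_of_near hB0 (by norm_num) U hρ0 hδ'0 hδ' hF (hεU.trans hεB) hgs
    refine h.trans ?_
    calc (Real.exp (6 * B) * Real.sqrt (π / B) ^ 9 / (2 * π ^ 2) ^ 3) *
          ((1 + 18 * (9 / 4 * δ' + (1 / 2 + 0) * (2 * Real.sqrt 2 * √(wilsonAction su2Rep U) + 9 * δ' * (2 + 36 * δ'))))
            * Real.exp (B * wilsonAction su2Rep U * (9 * (1 / 2 + 0) ^ 2 * ‖zmCoord 1 U‖ ^ 2 + 18 * δ' * (1 / 2 + 0) - 1))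
            * (1 - 5 / 16 * min ((1 / 2 + 0) * (1 - 36 * δ') * ‖zmCoord 1 U‖ ^ 2) (1 / 500)) + 512 * Real.exp (-(B * δ' / 4)))
        ≤ (linkCE B / (1 - 27 / B)) * ((1 + 18 * ε₂) * Real.exp ((27 / 4 + 9 * δ') / 100000)
            * (1 - 5 / 16 * min (1 / 2 * (1 - 36 * δ') * t ^ 2) (1 / 500)) + 512 * Real.exp (-(B * δ' / 4))) :=
          mul_le_mul h𝒢 (by linarith only [hA])
            (add_nonneg (mul_nonneg (mul_nonneg (by linarith only [hε0]) (Real.exp_pos _).le) (by linarith only [hm500]))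
              (by positivity)) hL0
      _ ≤ _ := mul_le_mul_of_nonneg_left (le_max_right _ _) hL0

end Summit.QuantumFields.YangMills.Theorems.FemtoTransferGap

end
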